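import Summits.BirchSwinnertonDyer.BirchSwinnertonDyer.Theorems.SprungSharpFlatMainConjecture
import Literature.NumberTheory.EllipticCurves.Sprung2017.SharpFlatNonvanishingProofs
import HarnessLib

/-!
# Kernel edges of the conjecture leaf `SprungSharpFlatMainConjecture` / `SprungSharpFlatLowerDivisibility`
# (Sprung 2012 Main Conj. 1.3 / 7.21 at `η = 1` on the REAL `X^•`) — theorems only, nothing asserted
# about any curve

STAGED by the cross-ladder LITERATURE-TYPING layer (cell `bsd-littype`, seat `bsd-littype-11` g3) next
to the leaf, for a planner to file under `Theorems/` (`--supports <item> --as helper`). Contents: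
* `sprungSharpFlatLowerDivisibility_of_mainConjecture` — the conjecture implies its Eisenstein half
  (`h = 1`), the ♯/♭ twin of `Supersingular.kobayashiLowerDivisibility_of_mainConjecture`;
* `exists_col_sharpFlatLowerDivisibility` — from the Eisenstein halves for BOTH colours, the binder
  `hdiv` of `Theorems.…KDotSplitReal.chromaticDivisibility_of_sharpFlatLowerDivisibility` (cell
  `bsd-ssimc`, crux `SprungLowerHalfAtThree`, stub (B)) for the pair `(W, p)`: SOME colour `•` (namely one
  with `L^• ≠ 0`, which exists by the tree theorem `Sprung2017.IsSprungPair.exists_chromaticL_ne_zero` =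
  Sprung 2012 Prop. 6.14, first sentence) such that for every dual datum `char X^• = (g)`,
  `ι g = ϖ · ι(L^• · h)` — so that the X8 rank-`0` residue of crux 5 reads
  «`∀ •, SprungSharpFlatLowerDivisibility W 3 •`» BY NAME (parity with X6 ⟸ `KobayashiLowerDivisibility`);
* `sharpFlatLowerDivisibility_hdiv_of_col` — the same for ONE colour with `L^• ≠ 0` given.
[cite: Sprung2012, Main Conj. 1.3 (p. 1486), Prop. 6.14 (p. 1498), Main Conj. 7.21 (p. 1505)]
-/

set_option linter.dupNamespace false
set_option autoImplicit false

noncomputable section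

open scoped Classical NumberField MatrixGroups ModularForm

open NumberField IsDedekindDomain CongruenceSubgroup WeierstrassCurve
  Literature.NumberTheory.EllipticCurves Literature.NumberTheory.EllipticCurves.ModularForms
  Literature.NumberTheory.EllipticCurves.ZpExtension Literature.NumberTheory.EllipticCurves.Sprung2017
  Literature.NumberTheory.EllipticCurves.Sprung2012

namespace Summit.BirchSwinnertonDyer.BirchSwinnertonDyer.Theorems

variable {W : WeierstrassCurve ℚ} [W.IsElliptic] [W.IsGloballyMinimal] {p : ℕ} [Fact p.Prime]

/-- The ♯/♭ main conjecture for `(E, p, •)` implies its Eisenstein half (`h = 1`).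
[cite: Sprung2012, Main Conj. 1.3 (p. 1486)] -/
theorem sprungSharpFlatLowerDivisibility_of_mainConjecture {col : Chroma}
    (h : SprungSharpFlatMainConjecture W p col) : SprungSharpFlatLowerDivisibility W p col := by
  intro κ γ hκ hγ hγ' v hv g hg cneg c hc N hN f ϖ Lsharp Lflat hf hϖ hSP hL0 D
  obtain ⟨_, gen, hgen, hι⟩ := h κ γ hκ hγ hγ' v hv g hg cneg c hc N hN f ϖ Lsharp Lflat hf hϖ hSP hL0 D
  exact ⟨gen, 1, hgen, by rw [mul_one, hι]⟩

/-- **(MC↓•) for ONE colour with `L^• ≠ 0`, in the shape of the route's binder**: from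
`SprungSharpFlatLowerDivisibility W p •` and `L^• ≠ 0`, for every dual datum of `Sel^•(E/ℚ_∞)` a
generator divisible by the Néron-normalised `ϖ · L^•`. [cite: Sprung2012, Main Conj. 7.21 (p. 1505)] -/
theorem sharpFlatLowerDivisibility_hdiv_of_col {col : Chroma}
    (h : SprungSharpFlatLowerDivisibility W p col)
    {κ : ZpExtension ℚ p} {γ : Field.absoluteGaloisGroup ℚ} (hκ : κ.IsCyclotomic)
    (hγ : κ.IsTopGenerator γ) (hγ' : IsCyclotomicVariable p γ)
    {v : HeightOneSpectrum (𝓞 ℚ)} (hv : (p : 𝓞 ℚ) ∈ v.asIdeal)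
    {g : Field.absoluteGaloisGroup (v.adicCompletion ℚ)}
    (hg : κ.IsTopGenerator (resGalOfEmb (closureEmb (K := ℚ) (v.adicCompletion ℚ)) g))
    {cneg : localPoints W (v.adicCompletion ℚ)} {c : ℕ → localPoints W (v.adicCompletion ℚ)}
    (hc : IsHondaSystem κ (closureEmb (K := ℚ) (v.adicCompletion ℚ)) W (W.frobeniusTrace p) g cneg c)
    {N : ℕ} (hN : NeZero N) {f : CuspForm (Gamma0 N) 2} {ϖ : ℚ} {Lsharp Lflat : IwasawaAlgebra p}
    (hf : IsNewformOf W f) (hϖ : (ϖ : ℝ) * W.realPeriodRat = plusPeriod f)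
    (hSP : IsSprungPair f p (W.frobeniusTrace p) Lsharp Lflat) (hL0 : chromaticL col Lsharp Lflat ≠ 0)
    (D : SharpFlatSelmerDualData W κ γ (closureEmb (K := ℚ) (v.adicCompletion ℚ))
      (W.frobeniusTrace p) g c col) :
    ∃ gen h' : IwasawaAlgebra p, D.charIdeal = Ideal.span {gen} ∧
      iwasawaToPowerSeries p gen =
        PowerSeries.C (ϖ : ℚ_[p]) * iwasawaToPowerSeries p (chromaticL col Lsharp Lflat * h') :=
  h κ γ hκ hγ hγ' v hv g hg cneg c hc N hN f ϖ Lsharp Lflat hf hϖ hSP hL0 D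

/-- **The binder `hdiv` of `…KDotSplitReal.chromaticDivisibility_of_sharpFlatLowerDivisibility` for
the pair `(W, p)`, from the Eisenstein halves for BOTH colours**: at a prime of good reduction some
colour `•` has `L^• ≠ 0` (`Sprung2017.IsSprungPair.exists_chromaticL_ne_zero`, Sprung 2012 Prop. 6.14
first sentence, PROVED in the tree through Rohrlich), and for that colour
`SprungSharpFlatLowerDivisibility W p •` is exactly the displayed divisibility. Hence the X8 rank-`0`
residue of crux 5 (B) reads «`∀ •, SprungSharpFlatLowerDivisibility W 3 •`» by name.
[cite: Sprung2012, Prop. 6.14 (p. 1498) and Main Conj. 7.21 (p. 1505)] -/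
theorem exists_col_sharpFlatLowerDivisibility
    (h : ∀ col : Chroma, SprungSharpFlatLowerDivisibility W p col)
    (hgood : W.HasGoodReductionAtPrime p)
    (κ : ZpExtension ℚ p) (γ : Field.absoluteGaloisGroup ℚ) (hκ : κ.IsCyclotomic)
    (hγ : κ.IsTopGenerator γ) (hγ' : IsCyclotomicVariable p γ)
    (v : HeightOneSpectrum (𝓞 ℚ)) (hv : (p : 𝓞 ℚ) ∈ v.asIdeal)
    (g : Field.absoluteGaloisGroup (v.adicCompletion ℚ))
    (hg : κ.IsTopGenerator (resGalOfEmb (closureEmb (K := ℚ) (v.adicCompletion ℚ)) g))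
    (cneg : localPoints W (v.adicCompletion ℚ)) (c : ℕ → localPoints W (v.adicCompletion ℚ))
    (hc : IsHondaSystem κ (closureEmb (K := ℚ) (v.adicCompletion ℚ)) W (W.frobeniusTrace p) g cneg c)
    (N : ℕ) (hN : NeZero N) (f : CuspForm (Gamma0 N) 2) (ϖ : ℚ) (Lsharp Lflat : IwasawaAlgebra p)
    (hf : IsNewformOf W f) (hϖ : (ϖ : ℝ) * W.realPeriodRat = plusPeriod f)
    (hSP : IsSprungPair f p (W.frobeniusTrace p) Lsharp Lflat) :
    ∃ col : Chroma,
      ∀ D : SharpFlatSelmerDualData W κ γ (closureEmb (K := ℚ) (v.adicCompletion ℚ))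
          (W.frobeniusTrace p) g c col,
        ∃ gen h' : IwasawaAlgebra p, D.charIdeal = Ideal.span {gen} ∧
          iwasawaToPowerSeries p gen =
            PowerSeries.C (ϖ : ℚ_[p]) * iwasawaToPowerSeries p (chromaticL col Lsharp Lflat * h') := by
  obtain ⟨col, hcol⟩ := hSP.exists_chromaticL_ne_zero hf hgood
  exact ⟨col, fun D => h col κ γ hκ hγ hγ' v hv g hg cneg c hc N hN f ϖ Lsharp Lflat hf hϖ hSP hcol D⟩

end Summit.BirchSwinnertonDyer.BirchSwinnertonDyer.Theorems

end
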